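import Mathlib.LinearAlgebra.SymplecticGroup
import Mathlib.LinearAlgebra.Matrix.SesquilinearForm
import Mathlib.Data.Matrix.ColumnRowPartitioned
import Mathlib.LinearAlgebra.FreeModule.PID
import Mathlib.LinearAlgebra.FiniteDimensional.Lemmas
import Mathlib.LinearAlgebra.Dual.Lemmas
import HarnessLib

/-!
# Goresky–Tai 2017, Proposition 44 (multiplier `−1`) and Proposition 50 (first assertion): over a ring in which
# `2` is a unit, an involution of multiplier `−1` is `Sp_{2n}`-conjugate to `τ₀ = (−1 0; 0 1)` as soon as its
# `(−1)`-eigenmodule is free — in particular over fields of characteristic `≠ 2` and over principal ideal domains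
# containing `½`; hence `H¹(⟨τ₀⟩, Sp_{2n}(R))` is trivial for such `R`

Goresky–Tai, *Real structures on ordinary abelian varieties*, arXiv:1701.07742, Appendix §19.1 p0043 and §20.6
p0047 (verbatim):

> «**Proposition 44.** ([Hua, Dieudonné, Huppert]) Let `R` be an integral domain that contains `½`.  Let
> `τ : R^{2n} → R^{2n}` be an `R`-linear mapping such that `τ² = I`, and suppose that conjugation by `τ` preserves
> `Sp_{2n}(R) ⊂ GL_{2n}(R)`.  Then `τ ∈ GSp_{2n}(R)` and its multiplier is `±1`.  If it is `−1` then `τ` is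
> `Sp_{2n}(R)`-conjugate to `τ₀`. …»
> Proof (the case `c = −1`): «Write `T = R^{2n}`.  The symplectic form `J` is (strongly) non-degenerate so it
> induces an isomorphism `T ≅ Hom(T, R)` say, `x ↦ x^♯`.  Let `T₊, T₋` be the `±1` eigenspaces of `τ`.  Since
> `2⁻¹ ∈ R`, any `x ∈ T` may be written `x = (x − τ(x))/2 + (x + τ(x))/2 ∈ T₋ + T₊` so `T = T₋ ⊕ T₊`. …  Let us
> consider the case `c = −1`, that is, `𝔅(τx, τy) = −𝔅(x, y)`.  It follows that `Φ(x, y) = (y^♯, x^♯)`, hence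
> `dim(T₋) = dim(T₊) = n` and we obtain an isomorphism `T₊ ≅ Hom(T₋, R)`.  Let `t_1, t_2, ⋯, t_n` be a basis
> of `T₋` and let `λ_1, ⋯, λ_n ∈ Hom(T₋, R)` be the dual basis.  Using `Φ`, the dual basis translates into a
> basis `t′_1, ⋯, t′_n` of `T₊`.  With respect to this basis `{t_1, ⋯, t_n, t′_1, ⋯, t′_n}` the matrix of the
> symplectic form is `J`, and the matrix of `τ` is `(−I 0; 0 I)`.»
> «**Proposition 50.** Let `R` be an integral domain containing `½`.  Then `H¹(⟨τ₀⟩, Sp_{2n}(R))` is trivial. …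
> Proof. By Proposition (prop-cohomology-involutions) [Prop. 47] cohomology classes in `Sp_{2n}(R)` correspond to
> conjugacy classes of involutions with multiplier `−1`.  If `½ ∈ R` then Proposition (prop-classification)
> [Prop. 44] says there is a unique such, hence the cohomology is trivial.»

## Scope note (the hypothesis «integral domain»)

The printed proof picks «a basis `t_1, ⋯, t_n` of `T₋`», i.e. it uses that the eigenmodule `T₋` (a direct summand
of `R^{2n}`, hence projective) is FREE.  Over an arbitrary integral domain containing `½` this can fail: if `R ⊇ ℚ`
is a Dedekind domain with a non-principal ideal `P` (e.g. the affine ring of an elliptic curve over `ℚ` minus its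
origin), then `L = (P ⊕ R^{n−1}) ⊕ (P^∨ ⊕ R^{n−1})` with its duality pairing is a free module `≅ R^{2n}` with a
standard symplectic form, and `τ = (−1) ⊕ 1` is an involution of multiplier `−1` whose `(−1)`-eigenmodule
`P ⊕ R^{n−1}` is not free; such a `τ` is not `Sp_{2n}(R)`-conjugate to `τ₀` (conjugacy would carry `T₋` onto the
free module `Rⁿ ⊕ 0`).  We therefore state the result for a commutative ring `R` with `2 ∈ R^×` UNDER THE HYPOTHESIS
that `T₋ = ker(τ + 1)` has a basis indexed by the `n` coordinates, and derive it unconditionally over fields of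
characteristic `≠ 2` (as GT use it for `ℝ`, `ℚ`, `ℚ_p`) and over principal ideal domains in which `2` is a unit
(`ℤ_p` for `p` odd, as in GT's (eqn-p-adic-cohomology); `ℤ[½]`).  (The counterexample is recorded here in prose
only.)  The tree's `SiegelModuli.exists_mem_symplecticGroup_mul_eq_mul_iStar_of_mul_self_eq_one` is the case
`R = ℝ`, index `Fin g`, of the field statement below.

## What is formalized (Mathlib conventions: `J = Matrix.J m R = (0 −1; 1 0)`, `Sp = Matrix.symplecticGroup m R`,
## multiplier `−1` as `ᵗτJτ = −J`, `τ₀ = (−1 0; 0 1)`, `h̃ = τ₀hτ₀`; `ω(u, v) = u ⬝ (Jv)`)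

* §1 (commutative `R`, `2 ∈ R^×`) «`T = T₋ ⊕ T₊`» and the pairing: `mem_kerSub_iff`, `mem_kerAdd_iff`,
  `isotropic_kerSub` / `isotropic_kerAdd` (`𝔅(τx, τy) = −𝔅(x, y)` makes `T₊`, `T₋` isotropic), `kerSub_sup_kerAdd`,
  `kerSub_inf_kerAdd`, `isCompl_kerSub_kerAdd` («`T = T₋ ⊕ T₊`»), `eq_zero_of_forall_dotProduct_mulVec` («`J` is
  (strongly) non-degenerate»), ★ `injective_pairing` (an isotropic summand embeds into the dual of its partner:
  `u ↦ (ω(u, b_j))_j` is injective on `T₊` for any basis `b` of `T₋`).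
* §2 ★★ `exists_symplectic_mul_eq_mul_tau0_of_basis` — **Proposition 44, multiplier `−1`, over any commutative
  ring with `2 ∈ R^×`, for `τ` with `T₋` free on the coordinate index**: `τh = hτ₀` for some `h ∈ Sp_{2n}(R)`
  (columns of `h`: the basis `t_j` of `T₋` and the vectors `t′_i ∈ T₊` with `ω(t′_i, t_j) = δ_{ij}` — «the dual
  basis translates into a basis of `T₊`», constructed from the strong non-degeneracy of `J` instead of a dimension
  count); `exists_symplectic_conj_eq_tau0_of_basis` (`h′τh = τ₀`, `h′h = 1`).
* §3 ★★ `exists_eq_inv_mul_twist_of_cocycle_of_basis` — **Proposition 50, first assertion, same generality**: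
  a `τ₀`-cocycle `g ∈ Sp_{2n}(R)` (`gg̃ = 1`) with `ker(gτ₀ + 1)` free on the coordinate index is a coboundary
  `g = k′k̃`, `kk′ = 1` («the cohomology is trivial»).
* §4 (fields `K`, `2 ≠ 0`) «`dim(T₋) = dim(T₊) = n`»: `finrank_kerSub_add_finrank_kerAdd`,
  `finrank_le_finrank_of_isotropic`, ★ `finrank_kerSub_eq_and_finrank_kerAdd_eq`; hence UNCONDITIONALLY
  ★★★ `exists_symplectic_mul_eq_mul_tau0` (Prop. 44, multiplier `−1`, over fields of characteristic `≠ 2`, any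
  finite index) and ★★★ `exists_eq_inv_mul_twist_of_cocycle` (**`H¹(⟨τ₀⟩, Sp_{2n}(K))` is trivial**).
* §5 (principal ideal domains with `2 ∈ R^×`) `T₋ ⊆ R^{2n}` is free (Mathlib `Submodule.basisOfPid`) of the right
  rank (`finrank` count through `T₊ ↪ T₋^*`, `T₋ ↪ T₊^*`): ★★★ `exists_symplectic_mul_eq_mul_tau0_of_isPrincipalIdealRing`,
  ★★★ `exists_eq_inv_mul_twist_of_cocycle_of_isPrincipalIdealRing`.
* §6 (GT §19.2, «`η² = λ.I` … `η` is `Sp_{2n}(R)`-conjugate to `(−uI_n 0; 0 uI_n)`» for `u = √λ`):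
  `exists_symplectic_mul_eq_mul_of_sq_eq_smul` — over a field of characteristic `≠ 2`, for `η` of multiplier `−λ`.

THEOREMS ONLY; no definition, instance, notation or named fact.

## References

* [GoreskyTai2017RealStructuresOrdinary] M. Goresky, Y.-S. Tai, *Real structures on ordinary abelian varieties*,
  arXiv:1701.07742 (2017), Appendix §19.1 Proposition 44 and its proof (case `c = −1`), §20.1 Proposition 47,
  §20.6 Proposition 50 (first assertion) and (eqn-p-adic-cohomology).
* [McDuffSalamon2017] D. McDuff, D. Salamon, *Introduction to Symplectic Topology*, 3rd ed. (2017), §2.1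
  Lemma 2.1.1, Thm 2.1.3 (Lagrangian splittings and adapted symplectic bases — the tree's `ℝ`-version).
-/

noncomputable section

open Matrix Module Function

namespace Literature.LinearAlgebra.Matrix

namespace SymplecticAntiInvolution

/-! ## §1 The eigenmodules `T₊ = ker(τ − 1)`, `T₋ = ker(τ + 1)` over a commutative ring with `2 ∈ R^×` -/

section CommRing

variable {R : Type*} [CommRing R] {n : Type*} [Fintype n] [DecidableEq n]

omit [DecidableEq n] in
/-- `ω(v, u) = −ω(u, v)` for `ω(u, v) = u ⬝ (Jv)` with `ᵗJ = −J`. [folklore] -/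
private theorem dotProduct_mulVec_swap {J : Matrix n n R} (hJT : Jᵀ = -J) (u v : n → R) :
    v ⬝ᵥ (J *ᵥ u) = -(u ⬝ᵥ (J *ᵥ v)) := by
  rw [Matrix.dotProduct_mulVec, dotProduct_comm, ← Matrix.mulVec_transpose, hJT, Matrix.neg_mulVec, dotProduct_neg]

omit [DecidableEq n] in
/-- «`𝔅(τx, τy) = −𝔅(x, y)`» for `ᵗτJτ = −J`. [cite: GoreskyTai2017RealStructuresOrdinary, App. §19.1 proof of
Proposition 44 («the case `c = −1`»)] -/
theorem dotProduct_mulVec_mulVec_eq_neg {e J : Matrix n n R} (hJ : eᵀ * J * e = -J) (u v : n → R) :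
    (e *ᵥ u) ⬝ᵥ (J *ᵥ (e *ᵥ v)) = -(u ⬝ᵥ (J *ᵥ v)) := by
  rw [Matrix.mulVec_mulVec, Matrix.dotProduct_mulVec, ← Matrix.vecMul_transpose, Matrix.vecMul_vecMul,
    ← Matrix.mul_assoc, hJ, Matrix.vecMul_neg, neg_dotProduct, ← Matrix.dotProduct_mulVec]

omit [DecidableEq n] in
/-- `T₊ = ker(τ − 1)`: `v ∈ T₊ ⟺ τv = v`. [cite: GoreskyTai2017RealStructuresOrdinary, App. §19.1 proof of
Proposition 44 («Let `T₊, T₋` be the `±1` eigenspaces of `τ`»)] -/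
theorem mem_kerSub_iff (e : Matrix n n R) (v : n → R) :
    v ∈ LinearMap.ker (e.mulVecLin - LinearMap.id) ↔ e *ᵥ v = v := by
  rw [LinearMap.mem_ker, LinearMap.sub_apply, LinearMap.id_apply, Matrix.mulVecLin_apply, sub_eq_zero]

omit [DecidableEq n] in
/-- `T₋ = ker(τ + 1)`: `v ∈ T₋ ⟺ τv = −v`. [cite: GoreskyTai2017RealStructuresOrdinary, App. §19.1 proof of
Proposition 44 («Let `T₊, T₋` be the `±1` eigenspaces of `τ`»)] -/
theorem mem_kerAdd_iff (e : Matrix n n R) (v : n → R) :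
    v ∈ LinearMap.ker (e.mulVecLin + LinearMap.id) ↔ e *ᵥ v = -v := by
  rw [LinearMap.mem_ker, LinearMap.add_apply, LinearMap.id_apply, Matrix.mulVecLin_apply, add_eq_zero_iff_eq_neg]

omit [Fintype n] [DecidableEq n] in
/-- `2x = 0 ⟹ x = 0` when `2` is a unit. [folklore] -/
private theorem eq_zero_of_two_mul_eq_zero (h2 : IsUnit (2 : R)) {x : R} (h : 2 * x = 0) : x = 0 := by
  have := h2.mul_left_cancel (h.trans (mul_zero (2 : R)).symm)
  exact this

omit [DecidableEq n] in
/-- **`T₊` is isotropic** («`𝔅(τx, τy) = −𝔅(x, y)`», so on `T₊`: `𝔅 = −𝔅`, and `2 ∈ R^×`).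
[cite: GoreskyTai2017RealStructuresOrdinary, App. §19.1 proof of Proposition 44 (case `c = −1`)] -/
theorem isotropic_kerSub (h2 : IsUnit (2 : R)) {e J : Matrix n n R} (hJ : eᵀ * J * e = -J)
    (u : n → R) (hu : u ∈ LinearMap.ker (e.mulVecLin - LinearMap.id))
    (v : n → R) (hv : v ∈ LinearMap.ker (e.mulVecLin - LinearMap.id)) : u ⬝ᵥ (J *ᵥ v) = 0 := by
  rw [mem_kerSub_iff] at hu hv
  have h := dotProduct_mulVec_mulVec_eq_neg hJ u v
  rw [hu, hv] at h
  exact eq_zero_of_two_mul_eq_zero h2 (by rw [two_mul]; nth_rewrite 1 [h]; exact neg_add_cancel _)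

omit [DecidableEq n] in
/-- **`T₋` is isotropic.** [cite: GoreskyTai2017RealStructuresOrdinary, App. §19.1 proof of Proposition 44 (case `c = −1`)] -/
theorem isotropic_kerAdd (h2 : IsUnit (2 : R)) {e J : Matrix n n R} (hJ : eᵀ * J * e = -J)
    (u : n → R) (hu : u ∈ LinearMap.ker (e.mulVecLin + LinearMap.id))
    (v : n → R) (hv : v ∈ LinearMap.ker (e.mulVecLin + LinearMap.id)) : u ⬝ᵥ (J *ᵥ v) = 0 := by
  rw [mem_kerAdd_iff] at hu hv
  have h := dotProduct_mulVec_mulVec_eq_neg hJ u v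
  rw [hu, hv, Matrix.mulVec_neg, neg_dotProduct, dotProduct_neg, neg_neg] at h
  exact eq_zero_of_two_mul_eq_zero h2 (by rw [two_mul]; nth_rewrite 1 [h]; exact neg_add_cancel _)

/-- «`J` is (strongly) non-degenerate»: `ω(u, ·) = 0 ⟹ u = 0` when `J² = −1`.
[cite: GoreskyTai2017RealStructuresOrdinary, App. §19.1 proof of Proposition 44] -/
theorem eq_zero_of_forall_dotProduct_mulVec {J : Matrix n n R} (hJJ : J * J = -1) {u : n → R}
    (h : ∀ w, u ⬝ᵥ (J *ᵥ w) = 0) : u = 0 := by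
  have h1 : u ᵥ* J = 0 := by
    ext i
    have := h (Pi.single i 1)
    rwa [Matrix.dotProduct_mulVec, dotProduct_single, mul_one] at this
  have h2 : (u ᵥ* J) ᵥ* J = -u := by
    rw [Matrix.vecMul_vecMul, hJJ, Matrix.vecMul_neg, Matrix.vecMul_one]
  rw [h1, Matrix.zero_vecMul] at h2
  exact neg_eq_zero.1 h2.symm

/-- **«`x = (x − τ(x))/2 + (x + τ(x))/2 ∈ T₋ + T₊`»**: `c(v + τv) ∈ T₊` for an involution `τ`.
[cite: GoreskyTai2017RealStructuresOrdinary, App. §19.1 proof of Proposition 44] -/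
theorem smul_add_mulVec_mem_kerSub {e : Matrix n n R} (he : e * e = 1) (c : R) (v : n → R) :
    c • (v + e *ᵥ v) ∈ LinearMap.ker (e.mulVecLin - LinearMap.id) := by
  rw [mem_kerSub_iff, Matrix.mulVec_smul, Matrix.mulVec_add, Matrix.mulVec_mulVec, he, Matrix.one_mulVec, add_comm]

/-- `c(v − τv) ∈ T₋` for an involution `τ`. [cite: GoreskyTai2017RealStructuresOrdinary, App. §19.1 proof of Proposition 44] -/
theorem smul_sub_mulVec_mem_kerAdd {e : Matrix n n R} (he : e * e = 1) (c : R) (v : n → R) :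
    c • (v - e *ᵥ v) ∈ LinearMap.ker (e.mulVecLin + LinearMap.id) := by
  rw [mem_kerAdd_iff, Matrix.mulVec_smul, Matrix.mulVec_sub, Matrix.mulVec_mulVec, he, Matrix.one_mulVec, ← smul_neg,
    neg_sub]

omit [DecidableEq n] in
/-- With `2t = 1`: `t(v + τv) + t(v − τv) = v`. [cite: GoreskyTai2017RealStructuresOrdinary, App. §19.1 proof of Proposition 44] -/
theorem smul_add_add_smul_sub {t : R} (ht : 2 * t = 1) (e : Matrix n n R) (v : n → R) :
    t • (v + e *ᵥ v) + t • (v - e *ᵥ v) = v := by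
  rw [← smul_add, add_add_sub_cancel, ← two_smul R v, smul_smul, mul_comm, ht, one_smul]

/-- **«`T = T₋ ⊕ T₊`», first half: `T₊ + T₋ = R^{2n}`** (for an involution, `2 ∈ R^×`).
[cite: GoreskyTai2017RealStructuresOrdinary, App. §19.1 proof of Proposition 44] -/
theorem kerSub_sup_kerAdd (h2 : IsUnit (2 : R)) {e : Matrix n n R} (he : e * e = 1) :
    LinearMap.ker (e.mulVecLin - LinearMap.id) ⊔ LinearMap.ker (e.mulVecLin + LinearMap.id) = ⊤ := by
  obtain ⟨t, ht⟩ : ∃ t : R, 2 * t = 1 := ⟨↑h2.unit⁻¹, h2.mul_val_inv⟩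
  refine Submodule.eq_top_iff'.2 fun v ↦ Submodule.mem_sup.2 ?_
  exact ⟨t • (v + e *ᵥ v), smul_add_mulVec_mem_kerSub he t v, t • (v - e *ᵥ v), smul_sub_mulVec_mem_kerAdd he t v,
    smul_add_add_smul_sub ht e v⟩

omit [DecidableEq n] in
/-- **«`T = T₋ ⊕ T₊`», second half: `T₊ ∩ T₋ = 0`** (`v = −v ⟹ 2v = 0`).
[cite: GoreskyTai2017RealStructuresOrdinary, App. §19.1 proof of Proposition 44] -/
theorem kerSub_inf_kerAdd (h2 : IsUnit (2 : R)) (e : Matrix n n R) :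
    LinearMap.ker (e.mulVecLin - LinearMap.id) ⊓ LinearMap.ker (e.mulVecLin + LinearMap.id) = ⊥ := by
  refine (Submodule.eq_bot_iff _).2 fun v hv ↦ ?_
  obtain ⟨hp, hq⟩ := Submodule.mem_inf.1 hv
  rw [mem_kerSub_iff] at hp
  rw [mem_kerAdd_iff, hp] at hq
  ext i
  have h3 : 2 * v i = 0 := by
    rw [two_mul]
    nth_rewrite 2 [hq]
    rw [Pi.neg_apply, add_neg_cancel]
  exact eq_zero_of_two_mul_eq_zero h2 h3

/-- **«`T = T₋ ⊕ T₊`»** as a complementary pair of submodules. [cite: GoreskyTai2017RealStructuresOrdinary, App. §19.1 proof of Proposition 44] -/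
theorem isCompl_kerSub_kerAdd (h2 : IsUnit (2 : R)) {e : Matrix n n R} (he : e * e = 1) :
    IsCompl (LinearMap.ker (e.mulVecLin - LinearMap.id)) (LinearMap.ker (e.mulVecLin + LinearMap.id)) :=
  ⟨disjoint_iff.2 (kerSub_inf_kerAdd h2 e), codisjoint_iff.2 (kerSub_sup_kerAdd h2 he)⟩

/-- If `P + Q = R^{2n}`, `P` is `ω`-isotropic and `u ∈ P` is `ω`-orthogonal to `Q`, then `u = 0`
(non-degeneracy). [cite: GoreskyTai2017RealStructuresOrdinary, App. §19.1 proof of Proposition 44 («`T₊ ≅ Hom(T₋, R)`»)] -/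
theorem eq_zero_of_forall_mem {J : Matrix n n R} (hJJ : J * J = -1) {P Q : Submodule R (n → R)}
    (hsup : P ⊔ Q = ⊤) (hP : ∀ u ∈ P, ∀ v ∈ P, u ⬝ᵥ (J *ᵥ v) = 0) {u : n → R} (hu : u ∈ P)
    (hQ : ∀ w ∈ Q, u ⬝ᵥ (J *ᵥ w) = 0) : u = 0 := by
  refine eq_zero_of_forall_dotProduct_mulVec hJJ fun w ↦ ?_
  have hw : w ∈ P ⊔ Q := by rw [hsup]; exact Submodule.mem_top
  obtain ⟨y, hy, z, hz, rfl⟩ := Submodule.mem_sup.1 hw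
  rw [Matrix.mulVec_add, dotProduct_add, hP u hu y hy, hQ z hz, add_zero]

/-- ★ **An isotropic summand embeds into the dual of its partner**: if `P + Q = R^{2n}`, `P` is isotropic and `b`
is a basis of `Q`, then `u ↦ (ω(u, b_j))_j` is injective on `P` («we obtain an isomorphism `T₊ ≅ Hom(T₋, R)`» —
the injectivity half, valid over any commutative ring). [cite: GoreskyTai2017RealStructuresOrdinary, App. §19.1
proof of Proposition 44] -/
theorem injective_pairing {J : Matrix n n R} (hJJ : J * J = -1) {P Q : Submodule R (n → R)} (hsup : P ⊔ Q = ⊤)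
    (hP : ∀ u ∈ P, ∀ v ∈ P, u ⬝ᵥ (J *ᵥ v) = 0) {ι : Type*} (b : Basis ι R Q) :
    Function.Injective fun u : P => fun j : ι => (u : n → R) ⬝ᵥ (J *ᵥ ((b j : Q) : n → R)) := by
  intro u u' huu'
  rw [← sub_eq_zero]
  apply Subtype.ext
  refine eq_zero_of_forall_mem hJJ hsup hP (u - u').2 fun w hw ↦ ?_
  -- `ω(u − u′, ·)` vanishes on the basis `b`, hence on `Q`
  have hb : ∀ j, ((u - u' : P) : n → R) ⬝ᵥ (J *ᵥ ((b j : Q) : n → R)) = 0 := fun j ↦ by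
    have := congr_fun huu' j
    simp only at this
    rw [Submodule.coe_sub, sub_dotProduct, this, sub_self]
  let φ : Q →ₗ[R] R := ((Matrix.toLinearMap₂' R J) ((u - u' : P) : n → R)).comp Q.subtype
  have hφ : φ = 0 := b.ext fun j => by
    rw [LinearMap.zero_apply, LinearMap.comp_apply, Submodule.subtype_apply, Matrix.toLinearMap₂'_apply']
    exact hb j
  have := LinearMap.congr_fun hφ ⟨w, hw⟩
  rwa [LinearMap.zero_apply, LinearMap.comp_apply, Submodule.subtype_apply, Matrix.toLinearMap₂'_apply'] at this

end CommRing

/-! ## §2 Proposition 44, multiplier `−1`: `τh = hτ₀` with `h ∈ Sp_{2n}(R)`, given a basis of `T₋` -/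

section Construction

variable {R : Type*} [CommRing R] {m : Type*} [Fintype m] [DecidableEq m]

/-- The `(i, j)` entry of `ᵗX J Y` is `ω(X_i, Y_j)` for the columns `X_i`, `Y_j`. [folklore] -/
private theorem transpose_mul_mul_apply {n k k' : Type*} [Fintype n] (X : Matrix n k R) (J : Matrix n n R)
    (Y : Matrix n k' R) (i : k) (j : k') :
    (Xᵀ * J * Y) i j = (fun a ↦ X a i) ⬝ᵥ (J *ᵥ fun a ↦ Y a j) := by
  rw [Matrix.mul_assoc]
  rfl

/-- `(Jℓ) ⬝ (Jw) = ℓ ⬝ w` (`ᵗJJ = 1`). [folklore] -/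
private theorem J_mulVec_dotProduct_J_mulVec (ℓ w : m ⊕ m → R) :
    (Matrix.J m R *ᵥ ℓ) ⬝ᵥ (Matrix.J m R *ᵥ w) = ℓ ⬝ᵥ w := by
  rw [Matrix.dotProduct_mulVec, ← Matrix.vecMul_transpose, Matrix.vecMul_vecMul, Matrix.J_transpose, neg_mul,
    Matrix.J_squared, neg_neg, Matrix.vecMul_one]

/-- ★★ **Goresky–Tai 2017, Proposition 44 (the case of multiplier `−1`), over a commutative ring `R` with
`2 ∈ R^×`, for an involution whose `(−1)`-eigenmodule is free on the coordinate index.**  If `τ² = 1`,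
`ᵗτJτ = −J` and `b` is a basis of `T₋ = ker(τ + 1) ⊆ R^{2n}` indexed by the `n` coordinates, then `τh = hτ₀` for
some `h ∈ Sp_{2n}(R)`, `τ₀ = (−1 0; 0 1)`: the columns of `h` are the `t_j = b_j` followed by the vectors
`t′_i ∈ T₊` with `ω(t′_i, t_j) = δ_{ij}` («the dual basis translates into a basis `t′_1, ⋯, t′_n` of `T₊`.  With
respect to this basis … the matrix of the symplectic form is `J`, and the matrix of `τ` is `(−I 0; 0 I)`»).  The
`t′_i` are produced by the strong non-degeneracy of `J`: `t′_i = ½(u + τu)` for `u = Jℓ_i`, `ℓ_i` representing the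
`i`-th coordinate functional of `b` composed with the projection `x ↦ ½(x − τx)` onto `T₋`.
[cite: GoreskyTai2017RealStructuresOrdinary, App. §19.1 Proposition 44 and proof (case `c = −1`)] -/
theorem exists_symplectic_mul_eq_mul_tau0_of_basis (h2 : IsUnit (2 : R)) {τ : Matrix (m ⊕ m) (m ⊕ m) R}
    (hττ : τ * τ = 1) (hJ : τᵀ * Matrix.J m R * τ = -Matrix.J m R)
    (b : Basis m R (LinearMap.ker (τ.mulVecLin + LinearMap.id))) :
    ∃ h ∈ Matrix.symplecticGroup m R, τ * h = h * fromBlocks (-1 : Matrix m m R) 0 0 (1 : Matrix m m R) := by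
  classical
  obtain ⟨t, ht⟩ : ∃ t : R, 2 * t = 1 := ⟨↑h2.unit⁻¹, h2.mul_val_inv⟩
  set P : Submodule R (m ⊕ m → R) := LinearMap.ker (τ.mulVecLin - LinearMap.id) with hPdef
  set Q : Submodule R (m ⊕ m → R) := LinearMap.ker (τ.mulVecLin + LinearMap.id) with hQdef
  have hJJ : Matrix.J m R * Matrix.J m R = -1 := Matrix.J_squared _ _
  have hsup : P ⊔ Q = ⊤ := kerSub_sup_kerAdd h2 hττ
  -- the projection `x ↦ t(x − τx)` onto `Q = T₋`, as a linear map
  let πm : (m ⊕ m → R) →ₗ[R] Q :=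
    LinearMap.codRestrict Q (t • (LinearMap.id - τ.mulVecLin)) fun w => by
      simpa only [LinearMap.smul_apply, LinearMap.sub_apply, LinearMap.id_apply, Matrix.mulVecLin_apply] using
        smul_sub_mulVec_mem_kerAdd hττ t w
  have hπm : ∀ w, ((πm w : Q) : m ⊕ m → R) = t • (w - τ *ᵥ w) := fun w => rfl
  have hπm_of_mem : ∀ w (hw : w ∈ Q), πm w = ⟨w, hw⟩ := fun w hw => by
    apply Subtype.ext
    rw [hπm, (mem_kerAdd_iff τ w).1 hw, sub_neg_eq_add, ← two_smul R w, smul_smul, mul_comm, ht, one_smul]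
  -- the coordinate functionals `L_i = (b-coordinate i) ∘ πm` and their representing vectors `ℓ_i`
  let L : m → (m ⊕ m → R) →ₗ[R] R := fun i => (LinearMap.proj i).comp (b.equivFun.toLinearMap.comp πm)
  have hL_apply : ∀ i w, L i w = b.equivFun (πm w) i := fun i w => rfl
  let ℓ : m → m ⊕ m → R := fun i a => L i (Pi.single a 1)
  have hL : ∀ i w, L i w = ℓ i ⬝ᵥ w := by
    intro i w
    conv_lhs => rw [pi_eq_sum_univ' w]
    rw [map_sum, dotProduct_comm]
    refine Finset.sum_congr rfl fun a _ => ?_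
    rw [map_smul, smul_eq_mul]
  -- the dual vectors `c_i = t(u₀ + τu₀) ∈ P`, `u₀ = Jℓ_i`
  let c : m → m ⊕ m → R := fun i => t • (Matrix.J m R *ᵥ ℓ i + τ *ᵥ (Matrix.J m R *ᵥ ℓ i))
  have hcP : ∀ i, c i ∈ P := fun i => smul_add_mulVec_mem_kerSub hττ t _
  have hωQ : ∀ i (w : m ⊕ m → R), w ∈ Q → c i ⬝ᵥ (Matrix.J m R *ᵥ w) = L i w := by
    intro i w hw
    have hd : t • (Matrix.J m R *ᵥ ℓ i - τ *ᵥ (Matrix.J m R *ᵥ ℓ i)) ∈ Q := smul_sub_mulVec_mem_kerAdd hττ t _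
    have hsum := smul_add_add_smul_sub ht τ (Matrix.J m R *ᵥ ℓ i)
    calc c i ⬝ᵥ (Matrix.J m R *ᵥ w)
        = (c i + t • (Matrix.J m R *ᵥ ℓ i - τ *ᵥ (Matrix.J m R *ᵥ ℓ i))) ⬝ᵥ (Matrix.J m R *ᵥ w) -
            (t • (Matrix.J m R *ᵥ ℓ i - τ *ᵥ (Matrix.J m R *ᵥ ℓ i))) ⬝ᵥ (Matrix.J m R *ᵥ w) := by
          rw [add_dotProduct, add_sub_cancel_right]
      _ = (Matrix.J m R *ᵥ ℓ i) ⬝ᵥ (Matrix.J m R *ᵥ w) - 0 := by rw [hsum, isotropic_kerAdd h2 hJ _ hd _ hw]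
      _ = L i w := by rw [sub_zero, J_mulVec_dotProduct_J_mulVec, hL]
  have hcb : ∀ i j, c i ⬝ᵥ (Matrix.J m R *ᵥ ((b j : Q) : m ⊕ m → R)) = if j = i then 1 else 0 := fun i j => by
    rw [hωQ i _ (b j).2, hL_apply, hπm_of_mem _ (b j).2, Subtype.coe_eta, Basis.equivFun_self]
  have hb_mem : ∀ j, τ *ᵥ ((b j : Q) : m ⊕ m → R) = -((b j : Q) : m ⊕ m → R) :=
    fun j ↦ (mem_kerAdd_iff τ _).1 (b j).2
  have hc_mem : ∀ i, τ *ᵥ c i = c i := fun i ↦ (mem_kerSub_iff τ _).1 (hcP i)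
  -- the column matrices `Bm = (t_1 … t_n)`, `Cm = (t′_1 … t′_n)` and `h = (Bm | Cm)`
  set Bm : Matrix (m ⊕ m) m R := Matrix.of fun a j ↦ ((b j : Q) : m ⊕ m → R) a with hBmdef
  set Cm : Matrix (m ⊕ m) m R := Matrix.of fun a i ↦ c i a with hCmdef
  have hBcol : ∀ j, (fun a ↦ Bm a j) = ((b j : Q) : m ⊕ m → R) := fun j ↦ rfl
  have hCcol : ∀ i, (fun a ↦ Cm a i) = c i := fun i ↦ rfl
  have hBB : Bmᵀ * Matrix.J m R * Bm = 0 := by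
    ext i j
    rw [transpose_mul_mul_apply, hBcol, hBcol, Matrix.zero_apply]
    exact isotropic_kerAdd h2 hJ _ (b i).2 _ (b j).2
  have hCC : Cmᵀ * Matrix.J m R * Cm = 0 := by
    ext i j
    rw [transpose_mul_mul_apply, hCcol, hCcol, Matrix.zero_apply]
    exact isotropic_kerSub h2 hJ _ (hcP i) _ (hcP j)
  have hCB : Cmᵀ * Matrix.J m R * Bm = 1 := by
    ext i j
    rw [transpose_mul_mul_apply, hCcol, hBcol, hcb, Matrix.one_apply]
    simp only [eq_comm]
  have hBC : Bmᵀ * Matrix.J m R * Cm = -1 := by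
    ext i j
    rw [transpose_mul_mul_apply, hBcol, hCcol, dotProduct_mulVec_swap (Matrix.J_transpose _ _), hcb,
      Matrix.neg_apply, Matrix.one_apply]
  have heB : τ * Bm = -Bm := by
    ext a j
    rw [Matrix.mul_apply', hBcol, Matrix.neg_apply]
    exact congr_fun (hb_mem j) a
  have heC : τ * Cm = Cm := by
    ext a i
    rw [Matrix.mul_apply', hCcol]
    exact congr_fun (hc_mem i) a
  refine ⟨Matrix.fromCols Bm Cm, ?_, ?_⟩
  · rw [SymplecticGroup.mem_iff', Matrix.transpose_fromCols, Matrix.fromRows_mul, Matrix.fromRows_mul_fromCols,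
      hBB, hBC, hCB, hCC, Matrix.J]
  · rw [Matrix.mul_fromCols, heB, heC, Matrix.fromCols_mul_fromBlocks]
    simp

/-- If `h ∈ Sp` then `h` has a two-sided inverse `h′ = −Jᵗh J ∈ Sp`. [folklore] -/
private theorem exists_inv_of_mem {h : Matrix (m ⊕ m) (m ⊕ m) R} (hh : h ∈ Matrix.symplecticGroup m R) :
    ∃ h' ∈ Matrix.symplecticGroup m R, h * h' = 1 ∧ h' * h = 1 := by
  have h'h : -(Matrix.J m R * hᵀ * Matrix.J m R) * h = 1 := by
    rw [Matrix.neg_mul]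
    exact SymplecticGroup.inv_left_mul_aux hh
  exact ⟨-(Matrix.J m R * hᵀ * Matrix.J m R), SymplecticGroup.neg_mem (Submonoid.mul_mem _ (Submonoid.mul_mem _
    (SymplecticGroup.J_mem m R) (SymplecticGroup.transpose_mem hh)) (SymplecticGroup.J_mem m R)),
    mul_eq_one_comm.1 h'h, h'h⟩

/-- **«`τ` is `Sp_{2n}(R)`-conjugate to `τ₀`»** (same hypotheses): `h′τh = τ₀` with `h ∈ Sp_{2n}(R)`, `h′h = hh′ = 1`.
[cite: GoreskyTai2017RealStructuresOrdinary, App. §19.1 Proposition 44 (case of multiplier `−1`)] -/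
theorem exists_symplectic_conj_eq_tau0_of_basis (h2 : IsUnit (2 : R)) {τ : Matrix (m ⊕ m) (m ⊕ m) R}
    (hττ : τ * τ = 1) (hJ : τᵀ * Matrix.J m R * τ = -Matrix.J m R)
    (b : Basis m R (LinearMap.ker (τ.mulVecLin + LinearMap.id))) :
    ∃ h h' : Matrix (m ⊕ m) (m ⊕ m) R, h ∈ Matrix.symplecticGroup m R ∧ h' ∈ Matrix.symplecticGroup m R ∧
      h * h' = 1 ∧ h' * h = 1 ∧ h' * τ * h = fromBlocks (-1 : Matrix m m R) 0 0 (1 : Matrix m m R) := by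
  obtain ⟨h, hh, hτh⟩ := exists_symplectic_mul_eq_mul_tau0_of_basis h2 hττ hJ b
  obtain ⟨h', hh', hhh', hh'h⟩ := exists_inv_of_mem hh
  refine ⟨h, h', hh, hh', hhh', hh'h, ?_⟩
  rw [Matrix.mul_assoc, hτh, ← Matrix.mul_assoc, hh'h, Matrix.one_mul]

/-! ## §3 Proposition 50, first assertion: `τ₀`-cocycles of `Sp_{2n}(R)` are coboundaries -/

/-- `τ₀² = 1` over `R`. [cite: GoreskyTai2017RealStructuresOrdinary, App. §19.1 («The standard involution `τ₀`»)] -/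
theorem tau0_mul_tau0 :
    fromBlocks (-1 : Matrix m m R) 0 0 (1 : Matrix m m R) * fromBlocks (-1 : Matrix m m R) 0 0 (1 : Matrix m m R) = 1 := by
  rw [fromBlocks_multiply, ← fromBlocks_one]
  simp

omit [Fintype m] in
/-- `ᵗτ₀ = τ₀`. [cite: GoreskyTai2017RealStructuresOrdinary, App. §19.1 («The standard involution `τ₀`»)] -/
theorem transpose_tau0 :
    (fromBlocks (-1 : Matrix m m R) 0 0 (1 : Matrix m m R))ᵀ = fromBlocks (-1 : Matrix m m R) 0 0 (1 : Matrix m m R) := by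
  rw [fromBlocks_transpose]
  simp

/-- `τ₀Jτ₀ = −J`: `τ₀` has multiplier `−1`. [cite: GoreskyTai2017RealStructuresOrdinary, App. §19.1] -/
theorem tau0_mul_J_mul_tau0 :
    fromBlocks (-1 : Matrix m m R) 0 0 (1 : Matrix m m R) * Matrix.J m R * fromBlocks (-1 : Matrix m m R) 0 0 (1 : Matrix m m R) =
      -Matrix.J m R := by
  rw [Matrix.J, fromBlocks_multiply, fromBlocks_multiply, fromBlocks_neg]
  simp

/-- For `τ = gτ₀`: «`g = ττ₀` defines a cocycle since `gg̃ = 1`» — `τ² = 1 ⟺ g(τ₀gτ₀) = 1`.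
[cite: GoreskyTai2017RealStructuresOrdinary, App. §20.1 (before Proposition 47)] -/
theorem mul_tau0_mul_self_eq_one_iff (g : Matrix (m ⊕ m) (m ⊕ m) R) :
    g * fromBlocks (-1 : Matrix m m R) 0 0 (1 : Matrix m m R) * (g * fromBlocks (-1 : Matrix m m R) 0 0 (1 : Matrix m m R)) = 1 ↔
      g * (fromBlocks (-1 : Matrix m m R) 0 0 (1 : Matrix m m R) * g * fromBlocks (-1 : Matrix m m R) 0 0 (1 : Matrix m m R)) = 1 := by
  rw [show g * fromBlocks (-1 : Matrix m m R) 0 0 (1 : Matrix m m R) * (g * fromBlocks (-1 : Matrix m m R) 0 0 (1 : Matrix m m R)) =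
      g * (fromBlocks (-1 : Matrix m m R) 0 0 (1 : Matrix m m R) * g * fromBlocks (-1 : Matrix m m R) 0 0 (1 : Matrix m m R)) by
    simp only [Matrix.mul_assoc]]

/-- For `g ∈ Sp_{2n}(R)`, `τ = gτ₀` has multiplier `−1` («`τ ∈ Γ.τ₀`»).
[cite: GoreskyTai2017RealStructuresOrdinary, App. §20.1 Proposition 47] -/
theorem mul_tau0_multiplier {g : Matrix (m ⊕ m) (m ⊕ m) R} (hg : g ∈ Matrix.symplecticGroup m R) :
    (g * fromBlocks (-1 : Matrix m m R) 0 0 (1 : Matrix m m R))ᵀ * Matrix.J m R *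
        (g * fromBlocks (-1 : Matrix m m R) 0 0 (1 : Matrix m m R)) = -Matrix.J m R := by
  rw [SymplecticGroup.mem_iff'] at hg
  rw [transpose_mul, transpose_tau0]
  calc fromBlocks (-1 : Matrix m m R) 0 0 (1 : Matrix m m R) * gᵀ * Matrix.J m R * (g * fromBlocks (-1 : Matrix m m R) 0 0 (1 : Matrix m m R))
      = fromBlocks (-1 : Matrix m m R) 0 0 (1 : Matrix m m R) * (gᵀ * Matrix.J m R * g) * fromBlocks (-1 : Matrix m m R) 0 0 (1 : Matrix m m R) := by
        simp only [Matrix.mul_assoc]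
    _ = -Matrix.J m R := by rw [hg, tau0_mul_J_mul_tau0]

/-- ★★ **Goresky–Tai 2017, Proposition 50, first assertion, over a commutative ring `R` with `2 ∈ R^×`, for a
cocycle whose involution has free `(−1)`-eigenmodule.**  If `g ∈ Sp_{2n}(R)` is a `τ₀`-cocycle (`g·g̃ = 1`,
`g̃ = τ₀gτ₀`) and `ker(gτ₀ + 1) ⊆ R^{2n}` has a basis indexed by the coordinates, then `g = k′k̃` for some
`k ∈ Sp_{2n}(R)` with inverse `k′` — the class of `g` in `H¹(⟨τ₀⟩, Sp_{2n}(R))` is trivial («cohomology classes in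
`Sp_{2n}(R)` correspond to conjugacy classes of involutions with multiplier `−1` … there is a unique such, hence
the cohomology is trivial»). [cite: GoreskyTai2017RealStructuresOrdinary, App. §20.6 Proposition 50 (first
assertion) and proof; §20.1 Proposition 47] -/
theorem exists_eq_inv_mul_twist_of_cocycle_of_basis (h2 : IsUnit (2 : R)) {g : Matrix (m ⊕ m) (m ⊕ m) R}
    (hg : g ∈ Matrix.symplecticGroup m R)
    (hcoc : g * (fromBlocks (-1 : Matrix m m R) 0 0 (1 : Matrix m m R) * g * fromBlocks (-1 : Matrix m m R) 0 0 (1 : Matrix m m R)) = 1)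
    (b : Basis m R (LinearMap.ker ((g * fromBlocks (-1 : Matrix m m R) 0 0 (1 : Matrix m m R)).mulVecLin + LinearMap.id))) :
    ∃ k k' : Matrix (m ⊕ m) (m ⊕ m) R, k ∈ Matrix.symplecticGroup m R ∧ k * k' = 1 ∧
      g = k' * (fromBlocks (-1 : Matrix m m R) 0 0 (1 : Matrix m m R) * k * fromBlocks (-1 : Matrix m m R) 0 0 (1 : Matrix m m R)) := by
  obtain ⟨h, hh, hτh⟩ := exists_symplectic_mul_eq_mul_tau0_of_basis h2 ((mul_tau0_mul_self_eq_one_iff g).2 hcoc)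
    (mul_tau0_multiplier hg) b
  obtain ⟨h', hh', hhh', hh'h⟩ := exists_inv_of_mem hh
  -- `gτ₀h = hτ₀` ⟹ `g = hτ₀h′τ₀ = k′(τ₀kτ₀)` with `k = h′`, `k′ = h`
  refine ⟨h', h, hh', hh'h, ?_⟩
  calc g = g * fromBlocks (-1 : Matrix m m R) 0 0 (1 : Matrix m m R) * (h * h') * fromBlocks (-1 : Matrix m m R) 0 0 (1 : Matrix m m R) := by
        rw [hhh', Matrix.mul_one, Matrix.mul_assoc, tau0_mul_tau0, Matrix.mul_one]
    _ = (g * fromBlocks (-1 : Matrix m m R) 0 0 (1 : Matrix m m R) * h) * h' * fromBlocks (-1 : Matrix m m R) 0 0 (1 : Matrix m m R) := by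
        simp only [Matrix.mul_assoc]
    _ = h * (fromBlocks (-1 : Matrix m m R) 0 0 (1 : Matrix m m R) * h' * fromBlocks (-1 : Matrix m m R) 0 0 (1 : Matrix m m R)) := by
        rw [hτh]; simp only [Matrix.mul_assoc]

end Construction

/-! ## §4 Fields of characteristic `≠ 2`: «`dim(T₋) = dim(T₊) = n`», and the unconditional statements -/

section Field

variable {K : Type*} [Field K] {n : Type*} [Fintype n] [DecidableEq n]

/-- `dim T₊ + dim T₋ = 2n` for an involution over a field with `2 ≠ 0`.
[cite: GoreskyTai2017RealStructuresOrdinary, App. §19.1 proof of Proposition 44 («`T = T₋ ⊕ T₊`»)] -/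
theorem finrank_kerSub_add_finrank_kerAdd (h2 : (2 : K) ≠ 0) {e : Matrix n n K} (he : e * e = 1) :
    finrank K (LinearMap.ker (e.mulVecLin - LinearMap.id)) +
        finrank K (LinearMap.ker (e.mulVecLin + LinearMap.id)) = Fintype.card n := by
  rw [← Submodule.finrank_sup_add_finrank_inf_eq, kerSub_sup_kerAdd (isUnit_iff_ne_zero.2 h2) he,
    kerSub_inf_kerAdd (isUnit_iff_ne_zero.2 h2), finrank_top, finrank_bot, add_zero, Module.finrank_fintype_fun_eq_card]

/-- `ω` embeds an isotropic `P` into the dual of a partner `Q` (`P + Q = K^{2n}`), so `dim P ≤ dim Q`.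
[cite: GoreskyTai2017RealStructuresOrdinary, App. §19.1 proof of Proposition 44 («`T₊ ≅ Hom(T₋, R)`»)] -/
theorem finrank_le_finrank_of_isotropic {J : Matrix n n K} (hJJ : J * J = -1)
    {P Q : Submodule K (n → K)} (hsup : P ⊔ Q = ⊤) (hP : ∀ u ∈ P, ∀ v ∈ P, u ⬝ᵥ (J *ᵥ v) = 0) :
    finrank K P ≤ finrank K Q := by
  let Ψ : P →ₗ[K] Module.Dual K Q := (Matrix.toLinearMap₂' K J).domRestrict₁₂ P Q
  have hΨ : Function.Injective Ψ := by
    refine (injective_iff_map_eq_zero Ψ).2 fun u hu ↦ Subtype.ext ?_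
    refine eq_zero_of_forall_mem hJJ hsup hP u.2 fun w hw ↦ ?_
    have := LinearMap.congr_fun hu ⟨w, hw⟩
    rwa [LinearMap.domRestrict₁₂_apply, Matrix.toLinearMap₂'_apply', LinearMap.zero_apply] at this
  calc finrank K P ≤ finrank K (Module.Dual K Q) := LinearMap.finrank_le_finrank_of_injective hΨ
    _ = finrank K Q := Subspace.dual_finrank_eq

/-- ★ **«`dim(T₋) = dim(T₊) = n`»** for an involution of multiplier `−1` of `(K^{2n}, J)`, `char K ≠ 2` (both
eigenspaces are isotropic and complementary, and each embeds into the other's dual).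
[cite: GoreskyTai2017RealStructuresOrdinary, App. §19.1 proof of Proposition 44 (case `c = −1`)] -/
theorem finrank_kerSub_eq_and_finrank_kerAdd_eq {m : Type*} [Fintype m] [DecidableEq m] (h2 : (2 : K) ≠ 0)
    {e : Matrix (m ⊕ m) (m ⊕ m) K} (he : e * e = 1) (hJ : eᵀ * Matrix.J m K * e = -Matrix.J m K) :
    finrank K (LinearMap.ker (e.mulVecLin - LinearMap.id)) = Fintype.card m ∧
      finrank K (LinearMap.ker (e.mulVecLin + LinearMap.id)) = Fintype.card m := by
  have h2' : IsUnit (2 : K) := isUnit_iff_ne_zero.2 h2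
  have h1 := finrank_kerSub_add_finrank_kerAdd h2 he
  have hle := finrank_le_finrank_of_isotropic (Matrix.J_squared _ _) (kerSub_sup_kerAdd h2' he) (isotropic_kerSub h2' hJ)
  have hge : finrank K (LinearMap.ker (e.mulVecLin + LinearMap.id)) ≤ finrank K (LinearMap.ker (e.mulVecLin - LinearMap.id)) := by
    refine finrank_le_finrank_of_isotropic (Matrix.J_squared _ _) ?_ (isotropic_kerAdd h2' hJ)
    rw [sup_comm]
    exact kerSub_sup_kerAdd h2' he
  rw [Fintype.card_sum] at h1
  omega

variable {m : Type*} [Fintype m] [DecidableEq m]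

/-- ★★★ **Goresky–Tai 2017, Proposition 44 (multiplier `−1`) over a field of characteristic `≠ 2`: every
involution `τ` of `(K^{2n}, J)` with `ᵗτJτ = −J` satisfies `τh = hτ₀` for some `h ∈ Sp_{2n}(K)`** — unconditionally,
since `T₋` is a `K`-vector space of dimension `n`. [cite: GoreskyTai2017RealStructuresOrdinary, App. §19.1
Proposition 44 and proof (case `c = −1`)] -/
theorem exists_symplectic_mul_eq_mul_tau0 (h2 : (2 : K) ≠ 0) {τ : Matrix (m ⊕ m) (m ⊕ m) K}
    (hττ : τ * τ = 1) (hJ : τᵀ * Matrix.J m K * τ = -Matrix.J m K) :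
    ∃ h ∈ Matrix.symplecticGroup m K, τ * h = h * fromBlocks (-1 : Matrix m m K) 0 0 (1 : Matrix m m K) := by
  obtain ⟨-, hQ⟩ := finrank_kerSub_eq_and_finrank_kerAdd_eq h2 hττ hJ
  let b : Basis m K (LinearMap.ker (τ.mulVecLin + LinearMap.id)) :=
    (Module.finBasisOfFinrankEq K _ hQ).reindex (Fintype.equivFin m).symm
  exact exists_symplectic_mul_eq_mul_tau0_of_basis (isUnit_iff_ne_zero.2 h2) hττ hJ b

/-- **… hence `h′τh = τ₀` with `h ∈ Sp_{2n}(K)`, `hh′ = h′h = 1`** («`τ` is `Sp_{2n}(R)`-conjugate to `τ₀`»).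
[cite: GoreskyTai2017RealStructuresOrdinary, App. §19.1 Proposition 44 (case of multiplier `−1`)] -/
theorem exists_symplectic_conj_eq_tau0 (h2 : (2 : K) ≠ 0) {τ : Matrix (m ⊕ m) (m ⊕ m) K}
    (hττ : τ * τ = 1) (hJ : τᵀ * Matrix.J m K * τ = -Matrix.J m K) :
    ∃ h h' : Matrix (m ⊕ m) (m ⊕ m) K, h ∈ Matrix.symplecticGroup m K ∧ h' ∈ Matrix.symplecticGroup m K ∧
      h * h' = 1 ∧ h' * h = 1 ∧ h' * τ * h = fromBlocks (-1 : Matrix m m K) 0 0 (1 : Matrix m m K) := by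
  obtain ⟨-, hQ⟩ := finrank_kerSub_eq_and_finrank_kerAdd_eq h2 hττ hJ
  let b : Basis m K (LinearMap.ker (τ.mulVecLin + LinearMap.id)) :=
    (Module.finBasisOfFinrankEq K _ hQ).reindex (Fintype.equivFin m).symm
  exact exists_symplectic_conj_eq_tau0_of_basis (isUnit_iff_ne_zero.2 h2) hττ hJ b

/-- ★★★ **Goresky–Tai 2017, Proposition 50, first assertion, over a field of characteristic `≠ 2`:
`H¹(⟨τ₀⟩, Sp_{2n}(K))` is trivial** — every `τ₀`-cocycle `g ∈ Sp_{2n}(K)` (`gg̃ = 1`) is a coboundary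
`g = k′k̃`, `kk′ = 1`. [cite: GoreskyTai2017RealStructuresOrdinary, App. §20.6 Proposition 50 (first assertion) and
proof] -/
theorem exists_eq_inv_mul_twist_of_cocycle (h2 : (2 : K) ≠ 0) {g : Matrix (m ⊕ m) (m ⊕ m) K}
    (hg : g ∈ Matrix.symplecticGroup m K)
    (hcoc : g * (fromBlocks (-1 : Matrix m m K) 0 0 (1 : Matrix m m K) * g * fromBlocks (-1 : Matrix m m K) 0 0 (1 : Matrix m m K)) = 1) :
    ∃ k k' : Matrix (m ⊕ m) (m ⊕ m) K, k ∈ Matrix.symplecticGroup m K ∧ k * k' = 1 ∧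
      g = k' * (fromBlocks (-1 : Matrix m m K) 0 0 (1 : Matrix m m K) * k * fromBlocks (-1 : Matrix m m K) 0 0 (1 : Matrix m m K)) := by
  have hττ := (mul_tau0_mul_self_eq_one_iff g).2 hcoc
  obtain ⟨-, hQ⟩ := finrank_kerSub_eq_and_finrank_kerAdd_eq h2 hττ (mul_tau0_multiplier hg)
  let b : Basis m K (LinearMap.ker ((g * fromBlocks (-1 : Matrix m m K) 0 0 (1 : Matrix m m K)).mulVecLin + LinearMap.id)) :=
    (Module.finBasisOfFinrankEq K _ hQ).reindex (Fintype.equivFin m).symm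
  exact exists_eq_inv_mul_twist_of_cocycle_of_basis (isUnit_iff_ne_zero.2 h2) hg hcoc b

end Field

/-! ## §5 Principal ideal domains with `2 ∈ R^×` (`ℤ_p` for `p` odd, `ℤ[½]`, …) -/

section PID

variable {R : Type*} [CommRing R] [IsDomain R] [IsPrincipalIdealRing R] {m : Type*} [Fintype m] [DecidableEq m]

/-- Over a PID with `2 ∈ R^×`, the eigenmodule `T₋ = ker(τ + 1) ⊆ R^{2n}` of an involution of multiplier `−1` is
free of rank `n`: it is a submodule of a free module (Mathlib `Submodule.basisOfPid`), and the injections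
`T₊ ↪ T₋^*`, `T₋ ↪ T₊^*` with `T = T₊ ⊕ T₋` force both ranks to be `n`.
[cite: GoreskyTai2017RealStructuresOrdinary, App. §19.1 proof of Proposition 44 («`dim(T₋) = dim(T₊) = n`»)] -/
theorem nonempty_basis_kerAdd_of_isPrincipalIdealRing (h2 : IsUnit (2 : R)) {τ : Matrix (m ⊕ m) (m ⊕ m) R}
    (hττ : τ * τ = 1) (hJ : τᵀ * Matrix.J m R * τ = -Matrix.J m R) :
    Nonempty (Basis m R (LinearMap.ker (τ.mulVecLin + LinearMap.id))) := by
  classical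
  set P : Submodule R (m ⊕ m → R) := LinearMap.ker (τ.mulVecLin - LinearMap.id) with hPdef
  set Q : Submodule R (m ⊕ m → R) := LinearMap.ker (τ.mulVecLin + LinearMap.id) with hQdef
  obtain ⟨kP, bP⟩ := Submodule.basisOfPid (Pi.basisFun R (m ⊕ m)) P
  obtain ⟨kQ, bQ⟩ := Submodule.basisOfPid (Pi.basisFun R (m ⊕ m)) Q
  haveI : Module.Free R P := Module.Free.of_basis bP
  haveI : Module.Free R Q := Module.Free.of_basis bQ
  haveI : Module.Finite R P := Module.Finite.of_basis bP
  haveI : Module.Finite R Q := Module.Finite.of_basis bQ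
  have hP : finrank R P = kP := by rw [finrank_eq_card_basis bP, Fintype.card_fin]
  have hQ : finrank R Q = kQ := by rw [finrank_eq_card_basis bQ, Fintype.card_fin]
  have hJJ : Matrix.J m R * Matrix.J m R = -1 := Matrix.J_squared _ _
  have hsup : P ⊔ Q = ⊤ := kerSub_sup_kerAdd h2 hττ
  have hsup' : Q ⊔ P = ⊤ := by rw [sup_comm]; exact hsup
  -- `T₊ ↪ (Fin kQ → R)` and `T₋ ↪ (Fin kP → R)`
  have h1 : finrank R P ≤ kQ := by
    have := LinearMap.finrank_le_finrank_of_injective (f := LinearMap.pi fun j : Fin kQ =>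
      ((Matrix.toLinearMap₂' R (Matrix.J m R)).domRestrict₁₂ P Q).flip (bQ j)) ?_
    · simpa only [Module.finrank_fintype_fun_eq_card, Fintype.card_fin] using this
    · intro u u' huu'
      apply injective_pairing hJJ hsup (isotropic_kerSub h2 hJ) bQ
      funext j
      have := congr_fun huu' j
      simpa only [LinearMap.pi_apply, LinearMap.flip_apply, LinearMap.domRestrict₁₂_apply,
        Matrix.toLinearMap₂'_apply'] using this
  have h2' : finrank R Q ≤ kP := by
    have := LinearMap.finrank_le_finrank_of_injective (f := LinearMap.pi fun j : Fin kP =>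
      ((Matrix.toLinearMap₂' R (Matrix.J m R)).domRestrict₁₂ Q P).flip (bP j)) ?_
    · simpa only [Module.finrank_fintype_fun_eq_card, Fintype.card_fin] using this
    · intro u u' huu'
      apply injective_pairing hJJ hsup' (isotropic_kerAdd h2 hJ) bP
      funext j
      have := congr_fun huu' j
      simpa only [LinearMap.pi_apply, LinearMap.flip_apply, LinearMap.domRestrict₁₂_apply,
        Matrix.toLinearMap₂'_apply'] using this
  -- `kP + kQ = 2n`
  have hsum : finrank R P + finrank R Q = Fintype.card (m ⊕ m) := by
    rw [← Module.finrank_prod, LinearEquiv.finrank_eq (Submodule.prodEquivOfIsCompl P Q (isCompl_kerSub_kerAdd h2 hττ)),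
      Module.finrank_fintype_fun_eq_card]
  rw [Fintype.card_sum, hP, hQ] at *
  have hk : kQ = Fintype.card m := by omega
  exact ⟨bQ.reindex (Fintype.equivOfCardEq (by rw [Fintype.card_fin, hk]))⟩

/-- ★★★ **Goresky–Tai 2017, Proposition 44 (multiplier `−1`) over a principal ideal domain in which `2` is a unit**
(`ℤ_p`, `p` odd; `ℤ[½]`; any field of characteristic `≠ 2`): every involution `τ` of `(R^{2n}, J)` with
`ᵗτJτ = −J` satisfies `τh = hτ₀` for some `h ∈ Sp_{2n}(R)`.
[cite: GoreskyTai2017RealStructuresOrdinary, App. §19.1 Proposition 44 and proof (case `c = −1`)] -/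
theorem exists_symplectic_mul_eq_mul_tau0_of_isPrincipalIdealRing (h2 : IsUnit (2 : R)) {τ : Matrix (m ⊕ m) (m ⊕ m) R}
    (hττ : τ * τ = 1) (hJ : τᵀ * Matrix.J m R * τ = -Matrix.J m R) :
    ∃ h ∈ Matrix.symplecticGroup m R, τ * h = h * fromBlocks (-1 : Matrix m m R) 0 0 (1 : Matrix m m R) := by
  obtain ⟨b⟩ := nonempty_basis_kerAdd_of_isPrincipalIdealRing h2 hττ hJ
  exact exists_symplectic_mul_eq_mul_tau0_of_basis h2 hττ hJ b

/-- ★★★ **Goresky–Tai 2017, Proposition 50, first assertion, over a principal ideal domain with `2 ∈ R^×`: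
`H¹(⟨τ₀⟩, Sp_{2n}(R))` is trivial** — every `τ₀`-cocycle `g ∈ Sp_{2n}(R)` is a coboundary `g = k′k̃`, `kk′ = 1`.
In particular for `R = ℤ_p`, `p` odd («Equation (eqn-p-adic-cohomology) holds since `½ ∈ ℤ_p` for `p` odd»).
[cite: GoreskyTai2017RealStructuresOrdinary, App. §20.6 Proposition 50 (first assertion) and proof] -/
theorem exists_eq_inv_mul_twist_of_cocycle_of_isPrincipalIdealRing (h2 : IsUnit (2 : R)) {g : Matrix (m ⊕ m) (m ⊕ m) R}
    (hg : g ∈ Matrix.symplecticGroup m R)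
    (hcoc : g * (fromBlocks (-1 : Matrix m m R) 0 0 (1 : Matrix m m R) * g * fromBlocks (-1 : Matrix m m R) 0 0 (1 : Matrix m m R)) = 1) :
    ∃ k k' : Matrix (m ⊕ m) (m ⊕ m) R, k ∈ Matrix.symplecticGroup m R ∧ k * k' = 1 ∧
      g = k' * (fromBlocks (-1 : Matrix m m R) 0 0 (1 : Matrix m m R) * k * fromBlocks (-1 : Matrix m m R) 0 0 (1 : Matrix m m R)) := by
  obtain ⟨b⟩ := nonempty_basis_kerAdd_of_isPrincipalIdealRing h2 ((mul_tau0_mul_self_eq_one_iff g).2 hcoc)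
    (mul_tau0_multiplier hg)
  exact exists_eq_inv_mul_twist_of_cocycle_of_basis h2 hg hcoc b

end PID

/-! ## §6 GT §19.2: `η² = λ`, `λ = u²` — `η` is `Sp_{2n}`-conjugate to `(−u 0; 0 u)` -/

section SquareMultiplier

variable {K : Type*} [Field K] {m : Type*} [Fintype m] [DecidableEq m]

/-- **Goresky–Tai 2017, §19.2** («If the ring `R` contains both `2⁻¹` and `u = √λ` then the above argument shows
that `η` is `Sp_{2n}(R)`-conjugate to the matrix `(−uI_n 0; 0 uI_n)`»), over a field of characteristic `≠ 2`:
if `η² = λ·1` with `λ = u²`, `u ≠ 0`, and `η` has multiplier `−λ` (`ᵗηJη = −λJ` — the case of the printed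
«above argument», i.e. of multiplier `−1` after rescaling; the print leaves this condition implicit), then
`ηh = h·(−u ⊕ u)` for some `h ∈ Sp_{2n}(K)`: apply Proposition 44 to the involution `u⁻¹η`.
[cite: GoreskyTai2017RealStructuresOrdinary, App. §19.2 (the displayed matrix `(−uI_n 0; 0 uI_n)`)] -/
theorem exists_symplectic_mul_eq_mul_of_sq_eq_smul (h2 : (2 : K) ≠ 0) {u : K} (hu : u ≠ 0)
    {η : Matrix (m ⊕ m) (m ⊕ m) K} (hηη : η * η = (u * u) • (1 : Matrix (m ⊕ m) (m ⊕ m) K))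
    (hJ : ηᵀ * Matrix.J m K * η = -((u * u) • Matrix.J m K)) :
    ∃ h ∈ Matrix.symplecticGroup m K,
      η * h = h * fromBlocks (-(u • (1 : Matrix m m K))) 0 0 (u • (1 : Matrix m m K)) := by
  -- `τ = u⁻¹η` is an involution of multiplier `−1`
  have hsc : u⁻¹ * u⁻¹ * (u * u) = 1 := by field_simp
  have hττ : (u⁻¹ • η) * (u⁻¹ • η) = 1 := by
    rw [Matrix.smul_mul, Matrix.mul_smul, smul_smul, hηη, smul_smul, hsc, one_smul]
  have hJτ : (u⁻¹ • η)ᵀ * Matrix.J m K * (u⁻¹ • η) = -Matrix.J m K := by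
    rw [transpose_smul, Matrix.smul_mul, Matrix.smul_mul, Matrix.mul_smul, smul_smul, hJ, smul_neg, smul_smul, hsc,
      one_smul]
  obtain ⟨h, hh, hτh⟩ := exists_symplectic_mul_eq_mul_tau0 h2 hττ hJτ
  refine ⟨h, hh, ?_⟩
  have e := congrArg (fun X : Matrix (m ⊕ m) (m ⊕ m) K => u • X) hτh
  simp only [Matrix.smul_mul, smul_smul, mul_inv_cancel₀ hu, one_smul] at e
  rw [e, ← Matrix.mul_smul, fromBlocks_smul, smul_zero, smul_neg]

end SquareMultiplier

end SymplecticAntiInvolution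

end Literature.LinearAlgebra.Matrix
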